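import Summits.Ventures.DiscreteObjects.UnitDistance.PlaneSqrt11Four
import Summits.Ventures.DiscreteObjects.UnitDistance.TriangleFreeFieldPlanes
import HarnessLib

/-!
# `W₁₁` is a 109-vertex triangle-free 4-chromatic unit-distance graph (cell `pub-namedobj`, target (U), seat udg g12)

Framing (verbatim for the cell): lottery ticket; floor = certified bounds/negative ranges.

Packaging of the witness of `PlaneSqrt11Four.lean` as a plane unit-distance graph in the cell's sense
(`IsUnitDistanceRealisation`: an INJECTIVE map to the plane sending edges to unit distances): the 109 points
`pt11 (w11c v)` are pairwise distinct (the integer table is injective, checked by `decide`, and `√11` is irrational), every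
edge has length `1`, all coordinates lie in `ℚ(√11)`, the graph is triangle-free (`TriangleFreeFieldPlanes.lean`: `√3 ∉ ℚ(√11)`)
and `χ(W₁₁) = 4` (`chromaticNumber_w11Graph`).  For comparison (print, not used): the smallest triangle-free 4-chromatic
unit-distance graphs known have 17 vertices (Exoo–Ismailescu); `W₁₁`'s point is its coordinate field, not its size.
-/

noncomputable section

namespace Summit.Ventures.DiscreteObjects.UnitDistance

open SimpleGraph IntermediateField
open scoped IntermediateField

/-- KERNEL FACT: the coordinate table is injective on the 109 vertices. -/
theorem w11c_injective : ∀ v w : Fin 109, w11c v = w11c w → v = w := by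
  decide +kernel

/-- `a + b√11 = a' + b'√11` with integers forces `a = a'` and `b = b'` (`√11` is irrational). -/
theorem int_sqrt11_eq {a b a' b' : ℤ}
    (h : (a : ℝ) + (b : ℝ) * Real.sqrt 11 = (a' : ℝ) + (b' : ℝ) * Real.sqrt 11) : a = a' ∧ b = b' := by
  have hirr : Irrational (Real.sqrt ((11 : ℕ) : ℝ)) := (by norm_num : Nat.Prime 11).irrational_sqrt
  rw [Nat.cast_ofNat] at hirr
  have h' : ((a : ℝ) - a') = ((b' : ℝ) - b) * Real.sqrt 11 := by linarith
  by_cases hb : b = b'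
  · subst hb
    have : (a : ℝ) = a' := by simp at h'; linarith
    exact ⟨by exact_mod_cast this, rfl⟩
  · exfalso
    have hne : ((b' : ℝ) - b) ≠ 0 := by
      have : (b' : ℝ) ≠ b := by exact_mod_cast (Ne.symm hb)
      exact sub_ne_zero.2 this
    refine hirr ⟨(a - a') / (b' - b), ?_⟩
    push_cast
    rw [div_eq_iff hne, h', mul_comm]

/-- `pt11` is injective on integer data. -/
theorem pt11_injective {p q : ℤ × ℤ × ℤ × ℤ} (h : pt11 p = pt11 q) : p = q := by
  obtain ⟨a, b, c, e⟩ := p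
  obtain ⟨a', b', c', e'⟩ := q
  have h0 := congrArg (fun x : EuclideanSpace ℝ (Fin 2) => x 0) h
  have h1 := congrArg (fun x : EuclideanSpace ℝ (Fin 2) => x 1) h
  simp [pt11] at h0 h1
  obtain ⟨rfl, rfl⟩ := int_sqrt11_eq h0
  obtain ⟨rfl, rfl⟩ := int_sqrt11_eq h1
  rfl

/-- `W₁₁` IS A UNIT-DISTANCE GRAPH: `v ↦ pt11 (w11c v)` is injective and sends edges to unit distances. -/
theorem w11Graph_isUnitDistanceRealisation : IsUnitDistanceRealisation w11Graph (fun v => pt11 (w11c v)) :=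
  ⟨fun v w h => w11c_injective v w (pt11_injective h), fun _ _ h => dist_pt11_eq_one h⟩

/-- All 109 points of the realisation lie in `ℚ(√11)²`. -/
theorem w11Graph_points_mem (v : Fin 109) : pt11 (w11c v) ∈ fieldPoints ℚ⟮Real.sqrt 11⟯ := pt11_mem _

/-- `W₁₁` IS TRIANGLE-FREE (its realisation lives in `ℚ(√11)²`, where `√3 ∉ ℚ(√11)` forbids unit triangles). -/
theorem w11Graph_cliqueFree_three : w11Graph.CliqueFree 3 :=
  cliqueFree_three_of_realisation_in_fieldPoints w11Graph_isUnitDistanceRealisation _ w11Graph_points_mem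
    sqrt3_not_mem_adjoin_sqrt11

/-- SUMMARY: a triangle-free unit-distance graph on 109 vertices with chromatic number `4` and all coordinates in `ℚ(√11)`. -/
theorem w11Graph_summary :
    IsUnitDistanceRealisation w11Graph (fun v => pt11 (w11c v)) ∧ (∀ v : Fin 109, pt11 (w11c v) ∈ fieldPoints ℚ⟮Real.sqrt 11⟯) ∧
      w11Graph.CliqueFree 3 ∧ w11Graph.chromaticNumber = 4 :=
  ⟨w11Graph_isUnitDistanceRealisation, w11Graph_points_mem, w11Graph_cliqueFree_three, chromaticNumber_w11Graph⟩

/-- Hence also directly: the real plane contains a triangle-free 4-chromatic unit-distance graph with coordinates in `ℚ(√11)`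
(`χ(ℝ²) ≥ 4` by a triangle-free witness — weaker than the known `χ(ℝ²) ≥ 5`, recorded only as the realisation statement). -/
theorem not_colorable_three_plane_of_w11 : ¬ planeUnitDistanceGraph.Colorable 3 :=
  not_colorable_plane_of_realisation w11Graph_isUnitDistanceRealisation not_colorable_three_w11Graph

end Summit.Ventures.DiscreteObjects.UnitDistance
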